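import Summits.BirchSwinnertonDyer.Rank1Residual.Additive.KatoDescentKummerUnramifiedLimitIndex
import Summits.BirchSwinnertonDyer.Rank1Residual.Additive.KummerLevelClassBridge
import Summits.BirchSwinnertonDyer.Rank1Residual.X11b.LevelShiftMaps
import Literature.NumberTheory.EllipticCurves.BSDQuadraticDescentShaOddPartGeneralProofs
import HarnessLib

set_option autoImplicit false

/-!
# (R1-d), TOWARDS THE COMPACT SIDE, I: for `k ≫ 0` the second factor `[Sel^{(p^k)}(E/K) : H¹_{𝓚⊓ur@Σ}(K, E[p^k])]`
# is CARRIED BY THE MORDELL–WEIL CLASSES — `= [M_k : M_k ⊓ H¹_{𝓚⊓ur@Σ}]`, `M_k = ι_k⁻¹ κ_k(E(K))`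
# (seat `bsd-cm-prr-ty1` g11, cell `bsd-cm`; theorems only: no definition, no named fact, no instance, no `sorry`)

Part 28 of the seat's kernel cut of stub 3 `stub_rankOneCountReadingKato` of the Kato–Perrin-Riou skeletons v4 (cruxes
stmt-BirchSwinnertonDyer-19945 / -19223; = cell bsd-potss's held input 27322).  Parts 22–27 give (R1-d) at finite level
and its discrete limit: `[S_Σ : Sel_{p^∞}(E/K)] · [Sel^{(p^k)}(E/K) : H¹_{𝓚⊓ur@Σ}(K, E[p^k])] = ∏_{v∈Σ} p^{v_p(c_v)}` for
`k ≫ 0`.  The potss memo identifies the second factor with `p^a = [ℤ_p κ_∞(P) : 𝔥]` (Parts 19–21, COMPACT side).  THIS FILE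
is the first half of that identification, valid over any number field `K : Type`: the second factor only sees the
Kummer classes of `E(K)`.

* §1 (`E[p^∞]`-coefficients) `exists_kummerMapLevel_eq_of_mem_ker_of_nsmul_eq_zero` — a class of
  `D = ker (H¹(K, E[p^∞]) → H¹(K, E)) = E(K) ⊗ ℚ_p/ℤ_p` killed by `p^k` is a level-`k` Kummer class `κ_k(P)`
  (`range_kummerMapPInfty`, `exists_eq_tmul_prufGen`, `kummerMapLevel_level`, `exists_of_kummerMapLevel_eq_zero`);
  **`exists_kummerMapLevel_add_of_mem_selmerGroupPInfty`** — if `p^k • Sel_{p^∞}(E/K) ⊆ D` (binder `hsha`; = «`Ш(E/K)[p^∞]`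
  has exponent `≤ p^k`», discharged from `Finite Ш[p^∞]` in `exists_forall_pow_smul_mem_ker_primaryH1ToH1`) then for
  `k ≤ k'`: **`Sel_{p^∞}[p^{k'}] ⊆ κ_{k'}(E(K)) + Sel_{p^∞}[p^k]`** (`D` is `p^k`-divisible, `exists_pow_nsmul_eq_of_mem_ker_primaryH1ToH1`).
* §2 (local, at an ADDITIVE `v ∤ p`, `p` odd, `m ≥ 1`) **`map_levelIncl_restrictField_eq_zero_of_map_primaryInclusion_eq_zero`**:
  a class of `H¹(K_v, E[p^k])` dying in `H¹(K_v, E[p^∞])` (i.e. a local KUMMER class, X11b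
  `kummerLocalConditionAt_eq_ker_map_primaryInclusion`) already dies in `H¹(K_v, E[p^{k+m}])`: a cocycle with `ι_k φ = σb − b`
  has `p^k b ∈ E(K_v)[p^∞]`, killed by `p` (n1011 `inertia_torsion_of_hasAdditiveReductionAt`), so `b ∈ E[p^{k+m}]` and
  `levelIncl ∘ φ` is a coboundary (X11b `map_one_oneCocycleClass_eq_zero_iff`).
* §3 (level `p^{k+m}`; no torsion hypothesis on `E(K)`) `selmerGroup_le_comap_range_kummerMapLevel_sup_map_levelIncl`:
  **`Sel^{(p^{k+m})} ≤ M_{k+m} ⊔ levelIncl_*(Sel^{(p^k)})`**, `M_n := ι_n⁻¹(κ_n(E(K)))` (X11b `levelIncl`,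
  `map_primaryInclusion_map_levelIncl`; the bridge `map_primaryInclusion_kummerMapTorsion_eq_kummerMapLevel` reads `M_n` as the
  level-`p^n` Kummer image); `map_levelIncl_selmerGroup_le` — **`levelIncl_*(Sel^{(p^k)}) ≤ H¹_{𝓚⊓ur@Σ}(K, E[p^{k+m}])`** for
  `Σ` additive `∤ p`, `p` odd, `m ≥ 1` (§2 at `Σ`: the localizations VANISH there); hence
  **`relIndex_selmerGroup_eq_relIndex_comap_range_kummerMapLevel`:
  `[Sel^{(p^{k+m})}(E/K) : H¹_{𝓖'}] = [M_{k+m} : M_{k+m} ⊓ H¹_{𝓖'}]`** for every `𝓖'` of the shape «`𝓚 ⊓ H¹_ur` at `Σ`, `𝓚`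
  elsewhere» (`Sel = M ⊔ H¹_{𝓖'}`, `AddSubgroup.relIndex_sup_right`), and the `∀ n ≥ k + 1` reading.
* §4 (with Part 27, `Finite Ш[p^∞]`) **`exists_addSubgroup_relIndex_mul_relIndex_comap_range_kummerMapLevel_eq`**:
  `∃ S_Σ, Sel_{p^∞} ≤ S_Σ, [S_Σ : Sel_{p^∞}] ≠ 0, ∃ k₀ ≥ 1 ∀ k ≥ k₀ ∀ 𝓖': [S_Σ : Sel_{p^∞}] · [M_k : M_k ⊓ H¹_{𝓖'}] = ∏_{v∈Σ} p^{v_p(c_v)}`.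

HONEST LABEL: theorems only; no stub or item is closed; nothing is registered; nothing is asserted on 19945 / 19223;
the identification `[M_k : M_k ⊓ H¹_{𝓚⊓ur@Σ}] = p^a` on the rows (the compact bridge to Part 21's lattice exponent) is NOT
in this file; Kato's Main Conjecture and Perrin-Riou's conjecture are not touched; BSD is not proved for any curve.

References: [GreenbergLNM1716] §2, §5 (p. 114); [Kato2004Asterisque] §14.1, §14.8; [SilvermanAEC2009] VIII.§2, VII.6; [Rubin2000] 1.7.3.
-/

noncomputable section

open scoped Classical ContRepresentation NumberField
open Function Field NumberField IsDedekindDomain WeierstrassCurve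
open Literature.NumberTheory.EllipticCurves Literature.NumberTheory.GaloisRepresentations
  Literature.NumberTheory.GaloisRepresentations.DiscreteGaloisModule Literature.NumberTheory.GaloisCohomology
open Summit.BirchSwinnertonDyer.Rank1Residual.X11b.Levels Summit.BirchSwinnertonDyer.Rank1Residual.X11b.LocBridge
open Summit.BirchSwinnertonDyer.Rank1Residual.GaloisImage
open Summit.BirchSwinnertonDyer.Rank1Residual.Additive.LevelBridge

universe u

namespace Summit.BirchSwinnertonDyer.Rank1Residual.Additive.KummerUnramified

/-! ## §1 `Sel_{p^∞}[p^{k'}] ⊆ κ_{k'}(E(K)) + Sel_{p^∞}[p^k]` when `p^k • Sel_{p^∞} ⊆ E(K) ⊗ ℚ_p/ℤ_p` -/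

section PInfty

variable {K : Type u} [Field K] [NumberField K] (W : WeierstrassCurve K) [W.IsElliptic] (p : ℕ) [hp : Fact p.Prime]

/-- **`D[p^k] ⊆ κ_k(E(K))`**: a class of `D = ker (H¹(K, E[p^∞]) → H¹(K, E))` killed by `p^k` is a level-`k` Kummer class.
[cite: GreenbergLNM1716, §2 (pp. 62–63)] -/
theorem exists_kummerMapLevel_eq_of_mem_ker_of_nsmul_eq_zero (k : ℕ) {d : galH1Primary W p}
    (hd : d ∈ (primaryH1ToH1 W p).ker) (hk : p ^ k • d = 0) :
    ∃ P : W.toAffine.Point, kummerMapLevel W p W.zsmul_geomPoints_surjective_holds k P = d := by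
  have hdiv : W.zsmul_geomPoints_surjective := W.zsmul_geomPoints_surjective_holds
  rw [← W.range_kummerMapPInfty p hdiv] at hd
  obtain ⟨t, rfl⟩ := hd
  obtain ⟨P, N, rfl⟩ := exists_eq_tmul_prufGen W p t
  rw [kummerMapPInfty_tmul_prufGen] at hk ⊢
  by_cases hN : N ≤ k
  · obtain ⟨j, rfl⟩ := Nat.exists_eq_add_of_le hN
    exact ⟨p ^ j • P, kummerMapLevel_level W p hdiv N j (N + j) rfl P⟩
  · obtain ⟨j, hj⟩ := Nat.exists_eq_add_of_le (Nat.le_of_not_ge hN)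
    -- `κ_j(P) = p^k • κ_N(P) = 0`
    have h0 : kummerMapLevel W p hdiv j P = 0 := by
      rw [← kummerMapLevel_level W p hdiv j k N (by omega) P, map_nsmul]; exact hk
    obtain ⟨m, P₀, hP₀⟩ := exists_of_kummerMapLevel_eq_zero W p hdiv j P h0
    refine ⟨P₀, ?_⟩
    rw [← kummerMapLevel_level W p hdiv N m (N + m) rfl P, hP₀,
      kummerMapLevel_level W p hdiv k (j + m) (N + m) (by omega) P₀]

/-- **`Sel_{p^∞}[p^{k'}] ⊆ κ_{k'}(E(K)) + Sel_{p^∞}[p^k]`** (`k ≤ k'`) when `p^k • Sel_{p^∞}(E/K) ⊆ D` (binder `hsha`):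
`D` is `p^k`-divisible inside itself, so `p^k x = p^k d` with `d ∈ D[p^{k'}] ⊆ κ_{k'}(E(K))` and `t = x − d ∈ Sel_{p^∞}[p^k]`.
[cite: GreenbergLNM1716, §2 (pp. 62–63)] -/
theorem exists_kummerMapLevel_add_of_mem_selmerGroupPInfty {k k' : ℕ} (hkk' : k ≤ k')
    (hsha : ∀ x ∈ selmerGroupPInfty W p, p ^ k • x ∈ (primaryH1ToH1 W p).ker)
    {x : galH1Primary W p} (hx : x ∈ selmerGroupPInfty W p) (hxk : p ^ k' • x = 0) :
    ∃ (P : W.toAffine.Point) (t : galH1Primary W p), t ∈ selmerGroupPInfty W p ∧ p ^ k • t = 0 ∧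
      x = kummerMapLevel W p W.zsmul_geomPoints_surjective_holds k' P + t := by
  obtain ⟨d, hd, hdx⟩ := W.exists_pow_nsmul_eq_of_mem_ker_primaryH1ToH1 p k (hsha x hx)
  have hdk' : p ^ k' • d = 0 := by
    obtain ⟨j, rfl⟩ := Nat.exists_eq_add_of_le hkk'
    rw [add_comm, pow_add, mul_smul, hdx, ← mul_smul, ← pow_add, add_comm, hxk]
  obtain ⟨P, hP⟩ := exists_kummerMapLevel_eq_of_mem_ker_of_nsmul_eq_zero W p k' hd hdk'
  refine ⟨P, x - d, sub_mem hx (W.ker_primaryH1ToH1_le_selmerGroupPInfty p hd), ?_, ?_⟩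
  · rw [smul_sub, hdx, sub_self]
  · rw [hP]; abel

/-- **`Finite Ш(E/K)[p^∞] ⟹ ∃ k, p^k • Sel_{p^∞}(E/K) ⊆ D`** (the binder `hsha`): `Sel_{p^∞} → H¹(K, E)` lands in `Ш[p^∞]`
(`map_primaryH1ToH1_selmerGroupPInfty`), which one power of `p` kills. [cite: GreenbergLNM1716, §2 (pp. 62–63)] -/
theorem exists_forall_pow_smul_mem_ker_primaryH1ToH1 [Finite (AddCommGroup.primaryComponent W.sha p)] :
    ∃ k : ℕ, ∀ x ∈ selmerGroupPInfty W p, p ^ k • x ∈ (primaryH1ToH1 W p).ker := by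
  obtain ⟨k, hk⟩ := WeierstrassCurve.exists_pow_nsmul_primaryComponent_eq_zero W.sha p
  refine ⟨k, fun x hx => ?_⟩
  have hmem : primaryH1ToH1 W p x ∈ (selmerGroupPInfty W p).map (primaryH1ToH1 W p) :=
    AddSubgroup.mem_map_of_mem _ hx
  rw [W.map_primaryH1ToH1_selmerGroupPInfty p W.zsmul_geomPoints_surjective_holds] at hmem
  obtain ⟨g, hg, hgx⟩ := hmem
  have hg0 := hk ⟨g, hg⟩
  rw [Subtype.ext_iff, AddSubmonoidClass.coe_nsmul, ZeroMemClass.coe_zero] at hg0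
  rw [AddMonoidHom.mem_ker, map_nsmul, ← hgx, ← map_nsmul, hg0, map_zero]

end PInfty

/-! ## §2 Local: at an additive `v ∤ p` (`p` odd) a local Kummer class of level `p^k` dies in `H¹(K_v, E[p^{k+m}])` -/
section Local

variable {K : Type u} [Field K] [NumberField K] (W : WeierstrassCurve K) [W.IsElliptic] (p : ℕ) [hp : Fact p.Prime]

/-- **`levelIncl_* (ker ι_{k,v}) = 0` in `H¹(K_v, E[p^{k+m}])` at an additive `v ∤ p`, `p` odd, `m ≥ 1`.**  A cocycle `φ` of
`E[p^k]` with `ι_k φ(σ) = σb − b` (`b ∈ E[p^∞]`) has `p^k b` fixed by `Γ_{K_v}`, hence killed by `p` (Kodaira–Néron at an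
additive place, n1011 `inertia_torsion_of_hasAdditiveReductionAt`); so `b = ι_{k+m} a` and `levelIncl ∘ φ` is the coboundary
of `a`. [cite: GreenbergLNM1716, §5 proof of Prop. 5.8 (p. 114)] [cite: SilvermanAEC2009, VII.6.1–6.2] -/
theorem map_levelIncl_restrictField_eq_zero_of_map_primaryInclusion_eq_zero (hodd : p ≠ 2)
    (v : HeightOneSpectrum (𝓞 K)) (hpv : ((p : ℕ) : 𝓞 K) ∉ v.asIdeal) (hadd : W.HasAdditiveReductionAt v)
    (k m : ℕ) (hm : 1 ≤ m)
    (c : galoisCohomology (GaloisRep.restrictField (v.adicCompletion K) (W.torsionGaloisModule ((p ^ k : ℕ) : ℤ))) 1)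
    (hc : galoisCohomology.map ((primaryInclusion W p k).restrictField (v.adicCompletion K)) 1 c = 0) :
    galoisCohomology.map ((levelIncl W p k m).restrictField (v.adicCompletion K)) 1 c = 0 := by
  obtain ⟨φ, rfl⟩ := oneCocycleClass_surjective _ c
  obtain ⟨b, hb⟩ := (map_one_oneCocycleClass_eq_zero_iff _ φ).1 hc
  -- `p^k • b` is `Γ_{K_v}`-fixed
  have hfix : ∀ σ : absoluteGaloisGroup (v.adicCompletion K),
      GaloisRep.restrictField (v.adicCompletion K) (primaryGaloisModule W p) σ (p ^ k • b) = p ^ k • b := fun σ => by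
    have h0 : p ^ k • (GaloisRep.restrictField (v.adicCompletion K) (primaryGaloisModule W p) σ b - b) = 0 := by
      rw [← hb σ, ← map_nsmul, pow_nsmul_geomTorsion_eq_zero, map_zero]
    rwa [smul_sub, ← map_nsmul, sub_eq_zero] at h0
  -- additive reduction: `p` kills the fixed `p`-power torsion, so `p^(k+m) • b = 0`
  have hkill : p ^ (k + m) • b = 0 := by
    have h1 : p • (p ^ k • b) = 0 :=
      inertia_torsion_of_hasAdditiveReductionAt W p v hpv hodd hadd (p ^ k • b) fun τ _ => hfix τ
    obtain ⟨j, hj⟩ : ∃ j, m = j + 1 := ⟨m - 1, (Nat.sub_add_cancel hm).symm⟩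
    have hpow : p ^ (k + m) = p ^ j * (p * p ^ k) := by rw [hj]; ring
    rw [hpow, mul_smul, mul_smul, h1, smul_zero]
  obtain ⟨a, ha⟩ := exists_primaryInclusion_restrictField_eq_of_nsmul_eq_zero W p (k + m) (v.adicCompletion K) b hkill
  refine (map_one_oneCocycleClass_eq_zero_iff _ φ).2 ⟨a, fun σ => ?_⟩
  apply primaryInclusion_restrictField_injective W p (k + m) (v.adicCompletion K)
  have h' : (primaryInclusion W p (k + m)).restrictField (v.adicCompletion K)
        (GaloisRep.restrictField (v.adicCompletion K) (W.torsionGaloisModule ((p ^ (k + m) : ℕ) : ℤ)) σ a) =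
      GaloisRep.restrictField (v.adicCompletion K) (primaryGaloisModule W p) σ b := by
    rw [← ha]; exact ((primaryInclusion W p (k + m)).restrictField (v.adicCompletion K)).isIntertwining σ a
  calc (primaryInclusion W p (k + m)).restrictField (v.adicCompletion K)
          ((levelIncl W p k m).restrictField (v.adicCompletion K) (φ.1 σ))
        = (primaryInclusion W p k).restrictField (v.adicCompletion K) (φ.1 σ) :=
          primaryInclusion_levelIncl W p k m (φ.1 σ)
    _ = GaloisRep.restrictField (v.adicCompletion K) (primaryGaloisModule W p) σ b - b := hb σ
    _ = _ := by rw [map_sub, h', ha]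

end Local

/-! ## §3 Level `p^{k+m}`: `Sel^{(p^{k+m})} = M_{k+m} + levelIncl_*(Sel^{(p^k)})`, the second summand trivial at `Σ` -/

section Level

variable {K : Type u} [Field K] [NumberField K] (W : WeierstrassCurve K) [W.IsElliptic] (p : ℕ) [hp : Fact p.Prime]

/-- **`Sel^{(p^{k+m})}(E/K) ≤ ι_{k+m}⁻¹ κ_{k+m}(E(K)) ⊔ levelIncl_*(Sel^{(p^k)}(E/K))`** when `p^k • Sel_{p^∞} ⊆ D` (no
hypothesis on `E(K)_tors`: the first summand is a PREIMAGE): §1 on `ι_{k+m} y`, the `p^k`-torsion summand comes from level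
`p^k` (`im ι_k = H¹(K, E[p^∞])[p^k]`, `ι_{k+m} ∘ levelIncl_* = ι_k`). [cite: GreenbergLNM1716, §5 proof of Prop. 5.8 (p. 114)] -/
theorem selmerGroup_le_comap_range_kummerMapLevel_sup_map_levelIncl (k m : ℕ)
    (hsha : ∀ x ∈ selmerGroupPInfty W p, p ^ k • x ∈ (primaryH1ToH1 W p).ker) :
    (W.kummerSelmerStructure ((p ^ (k + m) : ℕ) : ℤ)).selmerGroup ≤
      ((kummerMapLevel W p W.zsmul_geomPoints_surjective_holds (k + m)).range).comap
          (galoisCohomology.map (primaryInclusion W p (k + m)) 1 :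
            galH1Torsion W ((p ^ (k + m) : ℕ) : ℤ) →+ W.galH1Primary p) ⊔
        ((W.kummerSelmerStructure ((p ^ k : ℕ) : ℤ)).selmerGroup).map
          (galoisCohomology.map (levelIncl W p k m) 1 :
            galH1Torsion W ((p ^ k : ℕ) : ℤ) →+ galH1Torsion W ((p ^ (k + m) : ℕ) : ℤ)) := by
  intro y hy
  have hιy : (galoisCohomology.map (primaryInclusion W p (k + m)) 1 :
      galH1Torsion W ((p ^ (k + m) : ℕ) : ℤ) →+ W.galH1Primary p) y ∈ selmerGroupPInfty W p := by
    have h := hy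
    rw [selmerGroup_kummerSelmerStructure_eq_comap W p (k + m), AddSubgroup.mem_comap] at h
    exact h
  have hyk := (mem_range_map_primaryInclusion_iff' W p (k + m) _).1 ⟨y, rfl⟩
  obtain ⟨P, t, ht, htk, hdec⟩ :=
    exists_kummerMapLevel_add_of_mem_selmerGroupPInfty W p (Nat.le_add_right k m) hsha hιy hyk
  obtain ⟨s, hs⟩ := (mem_range_map_primaryInclusion_iff' W p k t).2 htk
  have hsSel : s ∈ (W.kummerSelmerStructure ((p ^ k : ℕ) : ℤ)).selmerGroup := by
    rw [selmerGroup_kummerSelmerStructure_eq_comap W p k, AddSubgroup.mem_comap, hs]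
    exact ht
  have hLs : (galoisCohomology.map (primaryInclusion W p (k + m)) 1 :
        galH1Torsion W ((p ^ (k + m) : ℕ) : ℤ) →+ W.galH1Primary p)
      (galoisCohomology.map (levelIncl W p k m) 1 s) = t :=
    (map_primaryInclusion_map_levelIncl W p k m s).trans hs
  refine AddSubgroup.mem_sup.2 ⟨y - galoisCohomology.map (levelIncl W p k m) 1 s, ?_,
    galoisCohomology.map (levelIncl W p k m) 1 s, AddSubgroup.mem_map_of_mem _ hsSel, sub_add_cancel _ _⟩
  rw [AddSubgroup.mem_comap]
  refine ⟨P, ?_⟩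
  calc kummerMapLevel W p W.zsmul_geomPoints_surjective_holds (k + m) P
      = (kummerMapLevel W p W.zsmul_geomPoints_surjective_holds (k + m) P + t) - t := (add_sub_cancel_right _ _).symm
    _ = (galoisCohomology.map (primaryInclusion W p (k + m)) 1 :
            galH1Torsion W ((p ^ (k + m) : ℕ) : ℤ) →+ W.galH1Primary p) y -
          (galoisCohomology.map (primaryInclusion W p (k + m)) 1 :
            galH1Torsion W ((p ^ (k + m) : ℕ) : ℤ) →+ W.galH1Primary p)
              (galoisCohomology.map (levelIncl W p k m) 1 s) := by rw [← hdec, hLs]; rfl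
    _ = _ := (map_sub _ _ _).symm

/-- **`levelIncl_*(Sel^{(p^k)}(E/K)) ≤ H¹_{𝓖'}(K, E[p^{k+m}])`** for every Selmer structure `𝓖'` on `E[p^{k+m}]` of the shape
«`𝓚 ⊓ H¹_ur` at `Σ`, `𝓚` elsewhere», `Σ` additive places `∤ p`, `p` odd, `m ≥ 1`: `levelIncl_* s` is Selmer
(`ι_{k+m}(levelIncl_* s) = ι_k s ∈ Sel_{p^∞}`) and its localizations at `Σ` VANISH (§2; `𝓚_v = ker ι_{k,v}`, X11b).
[cite: GreenbergLNM1716, §5 proof of Prop. 5.8 (p. 114)] [cite: Kato2004Asterisque, §14.8 (p. 238)] -/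
theorem map_levelIncl_selmerGroup_le (hodd : p ≠ 2) (Q : Finset (HeightOneSpectrum (𝓞 K)))
    (hQp : ∀ v ∈ Q, ((p : ℕ) : 𝓞 K) ∉ v.asIdeal) (hQadd : ∀ v ∈ Q, W.HasAdditiveReductionAt v)
    (k m : ℕ) (hm : 1 ≤ m) (𝓖' : SelmerStructure (W.torsionGaloisModule ((p ^ (k + m) : ℕ) : ℤ)))
    (h𝓖'Q : ∀ v ∈ Q, 𝓖' (Sum.inr v) = W.kummerSelmerStructure ((p ^ (k + m) : ℕ) : ℤ) (Sum.inr v) ⊓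
      unramifiedSubgroup (GaloisRep.toLocal v (W.torsionGaloisModule ((p ^ (k + m) : ℕ) : ℤ))) 1)
    (h𝓖'nQ : ∀ v ∉ Q, 𝓖' (Sum.inr v) = W.kummerSelmerStructure ((p ^ (k + m) : ℕ) : ℤ) (Sum.inr v))
    (h𝓖'inl : ∀ w : InfinitePlace K, 𝓖' (Sum.inl w) = W.kummerSelmerStructure ((p ^ (k + m) : ℕ) : ℤ) (Sum.inl w)) :
    ((W.kummerSelmerStructure ((p ^ k : ℕ) : ℤ)).selmerGroup).map
        (galoisCohomology.map (levelIncl W p k m) 1 :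
          galH1Torsion W ((p ^ k : ℕ) : ℤ) →+ galH1Torsion W ((p ^ (k + m) : ℕ) : ℤ)) ≤ 𝓖'.selmerGroup := by
  rintro _ ⟨s, hs, rfl⟩
  have hs' := (SelmerStructure.mem_selmerGroup_iff _ s).1 hs
  -- `levelIncl_* s` is Selmer at level `p^{k+m}`
  have hsel : (galoisCohomology.map (levelIncl W p k m) 1 s) ∈
      (W.kummerSelmerStructure ((p ^ (k + m) : ℕ) : ℤ)).selmerGroup := by
    rw [selmerGroup_kummerSelmerStructure_eq_comap W p (k + m), AddSubgroup.mem_comap]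
    have h : s ∈ (W.kummerSelmerStructure ((p ^ k : ℕ) : ℤ)).selmerGroup := hs
    rw [selmerGroup_kummerSelmerStructure_eq_comap W p k, AddSubgroup.mem_comap] at h
    have e : (galoisCohomology.map (primaryInclusion W p (k + m)) 1 :
          galH1Torsion W ((p ^ (k + m) : ℕ) : ℤ) →+ W.galH1Primary p)
        (galoisCohomology.map (levelIncl W p k m) 1 s) =
        (galoisCohomology.map (primaryInclusion W p k) 1 : galH1Torsion W ((p ^ k : ℕ) : ℤ) →+ W.galH1Primary p) s :=
      map_primaryInclusion_map_levelIncl W p k m s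
    rw [e]; exact h
  have hsel' := (SelmerStructure.mem_selmerGroup_iff _ _).1 hsel
  rw [SelmerStructure.mem_selmerGroup_iff]
  intro u
  rcases u with w | v
  · rw [h𝓖'inl w]; exact hsel' _
  · by_cases hv : v ∈ Q
    · rw [h𝓖'Q v hv]
      -- the localization at `v ∈ Σ` vanishes
      have hn : ((p ^ k : ℕ) : ℤ) ≠ 0 := by exact_mod_cast pow_ne_zero k hp.out.ne_zero
      have hker : galoisCohomology.map ((primaryInclusion W p k).restrictField (v.adicCompletion K)) 1
          (galoisCohomology.localization (W.torsionGaloisModule ((p ^ k : ℕ) : ℤ)) (Sum.inr v) 1 s) = 0 := by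
        have h := hs' (Sum.inr v)
        have e : W.kummerSelmerStructure ((p ^ k : ℕ) : ℤ) (Sum.inr v) =
            (galoisCohomology.map ((primaryInclusion W p k).restrictField (v.adicCompletion K)) 1).ker :=
          X11b.LevelKummer.kummerLocalConditionAt_eq_ker_map_primaryInclusion W p k v (hQp v hv) hn
        rw [e] at h
        exact h
      have h0 : galoisCohomology.localization (W.torsionGaloisModule ((p ^ (k + m) : ℕ) : ℤ)) (Sum.inr v) 1
          (galoisCohomology.map (levelIncl W p k m) 1 s) = 0 := by
        rw [localization_map_one']
        exact map_levelIncl_restrictField_eq_zero_of_map_primaryInclusion_eq_zero W p hodd v (hQp v hv) (hQadd v hv)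
          k m hm _ hker
      rw [h0]
      exact zero_mem _
    · rw [h𝓖'nQ v hv]; exact hsel' _

/-- **The second factor of (R1-d) is carried by the Mordell–Weil classes:
`[Sel^{(p^{k+m})}(E/K) : H¹_{𝓖'}(K, E[p^{k+m}])] = [M_{k+m} : M_{k+m} ⊓ H¹_{𝓖'}]`, `M_n = ι_n⁻¹ κ_n(E(K))`** — for
`K : Type`, `p` odd, `Σ` additive places `∤ p`, `m ≥ 1`, `p^k • Sel_{p^∞}(E/K) ⊆ E(K) ⊗ ℚ_p/ℤ_p` (binder `hsha`;
no hypothesis on `E(K)_tors`), and every `𝓖'` of the shape «`𝓚 ⊓ H¹_ur` at `Σ`, `𝓚` elsewhere» (both indices as `AddSubgroup.relIndex` of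
`H¹_{𝓖'}`).  `Sel^{(p^{k+m})} = M_{k+m} ⊔ H¹_{𝓖'}` by the two previous theorems.
[cite: Kato2004Asterisque, §14.8 (p. 238) and §14.1 (p. 235)] [cite: GreenbergLNM1716, §5 proof of Prop. 5.8 (p. 114)] -/
theorem relIndex_selmerGroup_eq_relIndex_comap_range_kummerMapLevel (hodd : p ≠ 2)
    (Q : Finset (HeightOneSpectrum (𝓞 K)))
    (hQp : ∀ v ∈ Q, ((p : ℕ) : 𝓞 K) ∉ v.asIdeal) (hQadd : ∀ v ∈ Q, W.HasAdditiveReductionAt v)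
    (k m : ℕ) (hm : 1 ≤ m)
    (hsha : ∀ x ∈ selmerGroupPInfty W p, p ^ k • x ∈ (primaryH1ToH1 W p).ker)
    (𝓖' : SelmerStructure (W.torsionGaloisModule ((p ^ (k + m) : ℕ) : ℤ)))
    (h𝓖'Q : ∀ v ∈ Q, 𝓖' (Sum.inr v) = W.kummerSelmerStructure ((p ^ (k + m) : ℕ) : ℤ) (Sum.inr v) ⊓
      unramifiedSubgroup (GaloisRep.toLocal v (W.torsionGaloisModule ((p ^ (k + m) : ℕ) : ℤ))) 1)
    (h𝓖'nQ : ∀ v ∉ Q, 𝓖' (Sum.inr v) = W.kummerSelmerStructure ((p ^ (k + m) : ℕ) : ℤ) (Sum.inr v))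
    (h𝓖'inl : ∀ w : InfinitePlace K, 𝓖' (Sum.inl w) = W.kummerSelmerStructure ((p ^ (k + m) : ℕ) : ℤ) (Sum.inl w)) :
    𝓖'.selmerGroup.relIndex (W.kummerSelmerStructure ((p ^ (k + m) : ℕ) : ℤ)).selmerGroup =
      𝓖'.selmerGroup.relIndex
        (((kummerMapLevel W p W.zsmul_geomPoints_surjective_holds (k + m)).range).comap
          (galoisCohomology.map (primaryInclusion W p (k + m)) 1 :
            galH1Torsion W ((p ^ (k + m) : ℕ) : ℤ) →+ W.galH1Primary p)) := by
  have hle := selmerGroup_le_comap_range_kummerMapLevel_sup_map_levelIncl W p k m hsha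
  have hIU := map_levelIncl_selmerGroup_le W p hodd Q hQp hQadd k m hm 𝓖' h𝓖'Q h𝓖'nQ h𝓖'inl
  -- `H¹_{𝓖'} ≤ Sel^{(p^{k+m})}`
  have hU : 𝓖'.selmerGroup ≤ (W.kummerSelmerStructure ((p ^ (k + m) : ℕ) : ℤ)).selmerGroup := fun x hx => by
    rw [SelmerStructure.mem_selmerGroup_iff] at hx ⊢
    intro u
    rcases u with w | v
    · rw [← h𝓖'inl w]; exact hx _
    · by_cases hv : v ∈ Q
      · have h' := hx (Sum.inr v); rw [h𝓖'Q v hv] at h'; exact h'.1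
      · rw [← h𝓖'nQ v hv]; exact hx _
  -- `M ≤ Sel^{(p^{k+m})}`
  have hM : ((kummerMapLevel W p W.zsmul_geomPoints_surjective_holds (k + m)).range).comap
        (galoisCohomology.map (primaryInclusion W p (k + m)) 1 :
          galH1Torsion W ((p ^ (k + m) : ℕ) : ℤ) →+ W.galH1Primary p) ≤
      (W.kummerSelmerStructure ((p ^ (k + m) : ℕ) : ℤ)).selmerGroup := by
    rw [selmerGroup_kummerSelmerStructure_eq_comap W p (k + m)]
    refine AddSubgroup.comap_mono ?_
    rintro _ ⟨P, rfl⟩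
    exact W.ker_primaryH1ToH1_le_selmerGroupPInfty p
      (W.primaryH1ToH1_kummerMapLevel p W.zsmul_geomPoints_surjective_holds (k + m) P)
  have heq : (W.kummerSelmerStructure ((p ^ (k + m) : ℕ) : ℤ)).selmerGroup =
      ((kummerMapLevel W p W.zsmul_geomPoints_surjective_holds (k + m)).range).comap
          (galoisCohomology.map (primaryInclusion W p (k + m)) 1 :
            galH1Torsion W ((p ^ (k + m) : ℕ) : ℤ) →+ W.galH1Primary p) ⊔ 𝓖'.selmerGroup :=
    le_antisymm (hle.trans (sup_le_sup_left hIU _)) (sup_le hM hU)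
  rw [heq, AddSubgroup.relIndex_sup_right]

/-- The same for every level `n ≥ k + 1` (write `n = k + m`). [cite: Kato2004Asterisque, §14.8 (p. 238)] -/
theorem relIndex_selmerGroup_eq_relIndex_comap_range_kummerMapLevel_of_le (hodd : p ≠ 2)
    (Q : Finset (HeightOneSpectrum (𝓞 K)))
    (hQp : ∀ v ∈ Q, ((p : ℕ) : 𝓞 K) ∉ v.asIdeal) (hQadd : ∀ v ∈ Q, W.HasAdditiveReductionAt v)
    (k : ℕ) (hsha : ∀ x ∈ selmerGroupPInfty W p, p ^ k • x ∈ (primaryH1ToH1 W p).ker)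
    (n : ℕ) (hn : k + 1 ≤ n)
    (𝓖' : SelmerStructure (W.torsionGaloisModule ((p ^ n : ℕ) : ℤ)))
    (h𝓖'Q : ∀ v ∈ Q, 𝓖' (Sum.inr v) = W.kummerSelmerStructure ((p ^ n : ℕ) : ℤ) (Sum.inr v) ⊓
      unramifiedSubgroup (GaloisRep.toLocal v (W.torsionGaloisModule ((p ^ n : ℕ) : ℤ))) 1)
    (h𝓖'nQ : ∀ v ∉ Q, 𝓖' (Sum.inr v) = W.kummerSelmerStructure ((p ^ n : ℕ) : ℤ) (Sum.inr v))
    (h𝓖'inl : ∀ w : InfinitePlace K, 𝓖' (Sum.inl w) = W.kummerSelmerStructure ((p ^ n : ℕ) : ℤ) (Sum.inl w)) :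
    𝓖'.selmerGroup.relIndex (W.kummerSelmerStructure ((p ^ n : ℕ) : ℤ)).selmerGroup =
      𝓖'.selmerGroup.relIndex
        (((kummerMapLevel W p W.zsmul_geomPoints_surjective_holds n).range).comap
          (galoisCohomology.map (primaryInclusion W p n) 1 :
            galH1Torsion W ((p ^ n : ℕ) : ℤ) →+ W.galH1Primary p)) := by
  obtain ⟨m, rfl⟩ := Nat.exists_eq_add_of_le ((Nat.le_succ k).trans hn)
  exact relIndex_selmerGroup_eq_relIndex_comap_range_kummerMapLevel W p hodd Q hQp hQadd k m (by omega) hsha 𝓖' h𝓖'Q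
    h𝓖'nQ h𝓖'inl

end Level

/-! ## §4 With Part 27: (R1-d) with the second factor read on the Mordell–Weil classes -/
section Assembly

variable {K : Type} [Field K] [NumberField K] (W : WeierstrassCurve K) [W.IsElliptic] (p : ℕ) [hp : Fact p.Prime]

/-- **(R1-d) WITH THE SECOND FACTOR ON THE MORDELL–WEIL CLASSES.**  For `K : Type`, `p` odd, `Σ ⊆ T` (every `v ∈ Σ`
additive with `v ∤ p`; `T ⊇ {v ∣ p} ∪ {bad}`) and `Ш(E/K)[p^∞]` finite: with `S_Σ` THE subgroup «`p^∞`-Selmer local kernel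
off `Σ`, unramified at `Σ`» of `H¹(K, E[p^∞])` (Part 27), `Sel_{p^∞} ≤ S_Σ`, `[S_Σ : Sel_{p^∞}] ≠ 0`, and
`∃ k₀ ≥ 1, ∀ k ≥ k₀`, for every `𝓖'` on `E[p^k]` of the shape «`𝓚 ⊓ H¹_ur` at `Σ`, `𝓚` elsewhere»:
**`[S_Σ : Sel_{p^∞}(E/K)] · [M_k : M_k ⊓ H¹_{𝓖'}(K, E[p^k])] = ∏_{v∈Σ} p^{v_p(c_v)}`**, `M_k = ι_k⁻¹ κ_k(E(K))` the level-`p^k`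
Kummer image read through `E[p^∞]`.  On the rows (`E(ℚ) = ℤP ⊕ T`, `p ∤ #T`) `M_k` is the cyclic group generated by
`κ_{p^k}(P)`; the identification of the second factor with Part 21's `p^a` is the remaining compact-side step.
[cite: Kato2004Asterisque, §14.8 (p. 238) and (14.9.3) (p. 240)] [cite: Rubin2000, Thm. 1.7.3] [cite: GreenbergLNM1716, §5 (p. 114)] -/
theorem exists_addSubgroup_relIndex_mul_relIndex_comap_range_kummerMapLevel_eq (hodd : p ≠ 2)
    (Q T : Finset (HeightOneSpectrum (𝓞 K))) (hQT : Q ⊆ T)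
    (hQp : ∀ v ∈ Q, ((p : ℕ) : 𝓞 K) ∉ v.asIdeal) (hQadd : ∀ v ∈ Q, W.HasAdditiveReductionAt v)
    (hTp : ∀ v : HeightOneSpectrum (𝓞 K), ((p : ℕ) : 𝓞 K) ∈ v.asIdeal → v ∈ T)
    (hTbad : ∀ v : HeightOneSpectrum (𝓞 K), ¬ W.HasGoodReductionAt v → v ∈ T)
    [Finite (AddCommGroup.primaryComponent W.sha p)] :
    ∃ S : AddSubgroup (W.galH1Primary p),
      (∀ x, x ∈ S ↔
        (∀ v : HeightOneSpectrum (𝓞 K), v ∉ Q → x ∈ selmerLocalKerPrimary W (v.adicCompletion K) p) ∧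
        (∀ w : InfinitePlace K, x ∈ selmerLocalKerPrimary W w.Completion p) ∧
        (∀ v ∈ Q, galoisCohomology.localization (primaryGaloisModule W p) (Sum.inr v) 1 x ∈
          unramifiedSubgroup (GaloisRep.toLocal v (primaryGaloisModule W p)) 1)) ∧
      selmerGroupPInfty W p ≤ S ∧ (selmerGroupPInfty W p).relIndex S ≠ 0 ∧
      ∃ k₀ : ℕ, 1 ≤ k₀ ∧ ∀ k, k₀ ≤ k →
        ∀ (𝓖' : SelmerStructure (W.torsionGaloisModule ((p ^ k : ℕ) : ℤ))),
          (∀ v ∈ Q, 𝓖' (Sum.inr v) = W.kummerSelmerStructure ((p ^ k : ℕ) : ℤ) (Sum.inr v) ⊓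
            unramifiedSubgroup (GaloisRep.toLocal v (W.torsionGaloisModule ((p ^ k : ℕ) : ℤ))) 1) →
          (∀ v ∉ Q, 𝓖' (Sum.inr v) = W.kummerSelmerStructure ((p ^ k : ℕ) : ℤ) (Sum.inr v)) →
          (∀ w : InfinitePlace K, 𝓖' (Sum.inl w) = W.kummerSelmerStructure ((p ^ k : ℕ) : ℤ) (Sum.inl w)) →
          (selmerGroupPInfty W p).relIndex S *
              𝓖'.selmerGroup.relIndex
                (((kummerMapLevel W p W.zsmul_geomPoints_surjective_holds k).range).comap
                  (galoisCohomology.map (primaryInclusion W p k) 1 :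
                    galH1Torsion W ((p ^ k : ℕ) : ℤ) →+ W.galH1Primary p)) =
            ∏ v ∈ Q, p ^ padicValNat p
              ((W.baseChange (v.adicCompletion K)).localTamagawaNumber (v.adicCompletionIntegers K)) := by
  obtain ⟨S, hS, hle, hne, k₀, hk₀, h⟩ :=
    exists_addSubgroup_selmerGroupPInfty_le_and_relIndex_mul_eq W p hodd Q T hQT hQp hQadd hTp hTbad
  obtain ⟨e, he⟩ := exists_forall_pow_smul_mem_ker_primaryH1ToH1 W p
  refine ⟨S, hS, hle, hne, max k₀ (e + 1), le_trans hk₀ (le_max_left _ _), fun k hk 𝓖' h₁ h₂ h₃ => ?_⟩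
  rw [← relIndex_selmerGroup_eq_relIndex_comap_range_kummerMapLevel_of_le W p hodd Q hQp hQadd e he k
    ((le_max_right _ _).trans hk) 𝓖' h₁ h₂ h₃]
  exact h k ((le_max_left _ _).trans hk) 𝓖' h₁ h₂ h₃

end Assembly

end Summit.BirchSwinnertonDyer.Rank1Residual.Additive.KummerUnramified

end
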